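import Literature.Analysis.FluidPDE.CylindricalIntegration
import Literature.Analysis.FluidPDE.HeatDuhamelBack
import Literature.Analysis.FunctionSpaces.SmoothParametricIntegral
import Literature.Analysis.FunctionSpaces.TorusPlanarLift
import HarnessLib

/-!
# Planar lifts, I: vertical fibre integration of test functions on `ℝ³`

Analysis/FluidPDE support file (everything proved; no named facts) on the discharge path of the
named fact `Literature.Analysis.FluidPDE.KNSS2009_regularity_boundedWeak_ancient_planar`
(`KNSSRegularityPlanar`; Koch–Nadirashvili–Seregin–Šverák, Acta Math. 203 (2009) =
arXiv:0709.3599, §4 for bounded weak solutions of Navier–Stokes on `ℝ² × (−∞, 0)`, the input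
"By the results of Section 4" of the proof of Theorem 5.1, p. 9). KNSS write §4 once for all
dimensions `n` ("`u : ℝⁿ × (0, T) → ℝⁿ`", pp. 6–8); the tree renders it twice, for `n = 3`
(`KNSS2009_regularity_boundedWeak_ancient`, `KNSSRegularity`, under discharge through
`KNSSRegularityWindow` → `KNSSRegularityDecomposition` → `KNSSRegularityGalilean`) and for `n = 2`
(the planar fact). Rather than redoing the Oseen-kernel machinery of the `n = 3` programme in the
plane, the planar fact is *reduced to the spatial one* by the classical remark that a planar flow
is a three-dimensional flow which does not depend on `x₂` and has no vertical velocity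
(Majda–Bertozzi 2002, §2.3.1, two-and-a-half-dimensional flows with `u₃ ≡ 0`): a bounded weak
solution `u` on `ℝ² × I` lifts to the bounded weak solution `ũ(t, x) = (u(t, x₀, x₁), 0)` on
`ℝ³ × I` (`PlanarLiftWeak`), the `n = 3` fact applied to `ũ` returns a smooth representative
whose horizontal part restricted to the plane `x₂ = 0` satisfies every clause of the planar fact
(`KNSSRegularityPlanarOfSpace`).

The one analytic step of the lift is that **three-dimensional test fields can be integrated
along the vertical fibres**: if `ψ ∈ C_c^∞(I × ℝ³)` then the fibre integral `ψ̄(t, w) = ∫ ψ(t, (w, z)) dz` is in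
`C_c^∞(I × ℝ²)`, horizontal derivatives, the time derivative and the Laplacian pass under the
integral, and vertical derivatives integrate to zero — so that testing `ũ` against `ψ` is testing
`u` against `ψ̄` (Fubini). This file supplies that calculus:

* the horizontal projection `projXY : ℝ³ →L[ℝ] ℝ²` (an `abbrev` of the tree's
  `FunctionSpaces.Torus.planarProjE`) and embedding `embedXY : ℝ² →L[ℝ] ℝ³` (the tree's
  `FunctionSpaces.Torus.planarEmbed` restricted to `ℝ² × {0}`), their adjointness
  `⟪ι v, y⟫ = ⟪v, π y⟫`, and their relation to the tree's volume-preserving splitting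
  `cylSplit : ℝ³ ≃ᵐ ℝ × ℝ²` (`CylindricalIntegration`): `cylSplit.symm (z, w) = ι w + z e_z`;
* `lineIntegralAlong L e Φ p = ∫ Φ (L p + s e) ds`, the integral of `Φ : V → F` along the pencil of
  lines directed by `e ≠ 0` and parametrised linearly by `p ↦ L p` (general normed spaces), with,
  for `Φ ∈ C_c^∞`: the reduction to a fixed compact `s`-interval locally uniformly in `p`
  (`lineIntegralAlong_eq_intervalIntegral`), smoothness in `p` (`contDiff_lineIntegralAlong`, by
  the tree's `contDiff_parametric_intervalIntegral`), differentiation under the integral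
  (`fderiv_lineIntegralAlong_apply`) and `∫ DΦ(L p + s e)(e) ds = 0`
  (`lineIntegralAlong_fderiv_apply_self`, the fundamental theorem of calculus);
* the vertical fibre integral `vertInt Φ w = ∫ Φ (w₀, w₁, z) dz` of a static field on `ℝ³` and
  the slice-wise fibre integral `fiberInt ψ t = vertInt (ψ t)` of a time-dependent one, with
  `D(vertInt Φ)(w)(v) = vertInt (DΦ(·)(ι v)) w`, `vertInt (DΦ(·) e_z) = 0`,
  `Δ₂ (vertInt Φ) = vertInt (Δ₃ Φ)` (`laplacian_vertInt`), `∂ₜ (fiberInt ψ) = fiberInt (∂ₜ ψ)`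
  (`IsSpaceTimeTestOn.timeDeriv_fiberInt`), and: the fibre integral of a space–time test field on
  the slab `I × ℝ³` is a space–time test field on `I × ℝ²` (`isSpaceTimeTestOn_fiberInt`).

## Mathlib / tree search

Tree: `cylSplit`, `cylSplit_symm_apply`, `measurePreserving_cylSplit` (`CylindricalIntegration`);
`eZ = EuclideanSpace.single 2 1` (`AxisymmetricEuler`); `contDiff_parametric_intervalIntegral`,
`fderiv_parametric_intervalIntegral_apply` (`FunctionSpaces/SmoothParametricIntegral`);
`laplacian_eq_sum_fderiv_fderiv_normed`, `IsSpaceTimeTestOn.hasCompactSupport_slice`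
(`HeatDuhamelBack`, `ClassicalSolutionCalculus`); the Euclidean projection
`Torus.planarProjE : ℝ³ →L[ℝ] ℝ²` with `planarProjE_apply`, `norm_planarProjE_le`, and the
embedding `Torus.planarEmbed : ℝ² × ℝ →L[ℝ] ℝ³` with its evaluation lemmas (`TorusPlanarLift`,
already consumed in `FluidPDE/TwoHalfNavierStokes`) — reused here through the abbreviations
`projXY`, `embedXY` (short names for the many coordinate computations below;
`AxisymmetricLiftR5.horizProj` is the unrelated `ℝ⁵ → ℝ⁵` projection). Mathlib:
`intervalIntegral.integral_eq_sub_of_hasDerivAt`,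
`setIntegral_eq_integral_of_forall_compl_eq_zero`, `HasCompactSupport.exists_pos_le_norm`,
`HasCompactSupport.fderiv_apply`, `Filter.EventuallyEq.fderiv_eq`,
`ContDiffAt.congr_of_eventuallyEq`, `InnerProductSpace.laplacian_eq_iteratedFDeriv_orthonormalBasis`.

## References

* A. J. Majda, A. L. Bertozzi, *Vorticity and Incompressible Flow*, CUP 2002, §2.3.1
  (two-and-a-half-dimensional flows). [MajdaBertozziCUP2002]
* G. Koch, N. Nadirashvili, G. Seregin, V. Šverák, *Liouville theorems for the Navier–Stokes
  equations and applications*, Acta Math. 203 (2009) 83–105 = arXiv:0709.3599, §4 and the proof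
  of Theorem 5.1 (p. 9). [KochNadirashviliSereginSverak2009]
* L. Hörmander, *The Analysis of Linear Partial Differential Operators I*, 2nd ed. (1990),
  Thm. 1.1.9 (differentiation under the integral sign).
-/

noncomputable section

open MeasureTheory Set Function Filter Topology TopologicalSpace Metric WithLp
open scoped RealInnerProductSpace ContDiff Laplacian

namespace Literature.Analysis.FluidPDE

/-- Local notation for physical space `ℝ³ = EuclideanSpace ℝ (Fin 3)`. -/
local notation "ℝ³" => EuclideanSpace ℝ (Fin 3)

/-- Local notation for the horizontal plane `ℝ² = EuclideanSpace ℝ (Fin 2)`. -/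
local notation "ℝ²" => EuclideanSpace ℝ (Fin 2)

/-! ### The horizontal projection `ℝ³ → ℝ²` and embedding `ℝ² → ℝ³` -/

section XY

/-- The **horizontal projection** `π : ℝ³ → ℝ²`, `x ↦ (x₀, x₁)`, as a continuous linear map
(Majda–Bertozzi 2002, §2.3.1: the planar variables of a `2½`-dimensional flow): a short name
for the tree's `FunctionSpaces.Torus.planarProjE` (`TorusPlanarLift`; `projXY_eq`), kept as a
`def` so that `simp` does not unfold it past the coordinate lemmas below. [folklore] -/
def projXY : ℝ³ →L[ℝ] ℝ² :=
  FunctionSpaces.Torus.planarProjE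

/-- The **horizontal embedding** `ι : ℝ² → ℝ³`, `w ↦ (w₀, w₁, 0)`, as a continuous linear map:
the tree's `2½`-dimensional embedding `FunctionSpaces.Torus.planarEmbed : ℝ² × ℝ →L[ℝ] ℝ³`,
`(a, r) ↦ (a₀, a₁, r)`, restricted to `r = 0` (`embedXY_eq`). [folklore] -/
def embedXY : ℝ² →L[ℝ] ℝ³ :=
  FunctionSpaces.Torus.planarEmbed.comp (ContinuousLinearMap.inl ℝ ℝ² ℝ)

/-- Bridge: `projXY` is the tree's `Torus.planarProjE` (definitional). [folklore] -/
theorem projXY_eq : projXY = FunctionSpaces.Torus.planarProjE := rfl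

/-- Bridge: `embedXY` is the tree's `Torus.planarEmbed` on `ℝ² × {0}` (definitional). [folklore] -/
theorem embedXY_eq :
    embedXY = FunctionSpaces.Torus.planarEmbed.comp (ContinuousLinearMap.inl ℝ ℝ² ℝ) := rfl

/-- `ι w = planarEmbed (w, 0)`. [folklore] -/
theorem embedXY_apply_eq (w : ℝ²) : embedXY w = FunctionSpaces.Torus.planarEmbed (w, 0) := rfl

/-- `(π x)₀ = x₀`. [folklore] -/
@[simp] theorem projXY_apply_zero (x : ℝ³) : projXY x 0 = x 0 :=
  FunctionSpaces.Torus.planarProjE_apply x 0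

/-- `(π x)₁ = x₁`. [folklore] -/
@[simp] theorem projXY_apply_one (x : ℝ³) : projXY x 1 = x 1 :=
  FunctionSpaces.Torus.planarProjE_apply x 1

/-- `(ι w)₀ = w₀`. [folklore] -/
@[simp] theorem embedXY_apply_zero (w : ℝ²) : embedXY w 0 = w 0 := by
  rw [embedXY_apply_eq, FunctionSpaces.Torus.planarEmbed_apply_zero]

/-- `(ι w)₁ = w₁`. [folklore] -/
@[simp] theorem embedXY_apply_one (w : ℝ²) : embedXY w 1 = w 1 := by
  rw [embedXY_apply_eq, FunctionSpaces.Torus.planarEmbed_apply_one]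

/-- `(ι w)₂ = 0`. [folklore] -/
@[simp] theorem embedXY_apply_two (w : ℝ²) : embedXY w 2 = 0 := by
  rw [embedXY_apply_eq, FunctionSpaces.Torus.planarEmbed_apply_two]

/-- Coordinate form of `π`: `π x = (x₀, x₁)`. [folklore] -/
theorem projXY_eq_toLp (x : ℝ³) : projXY x = toLp 2 ![x 0, x 1] := by
  ext i; fin_cases i <;> simp

/-- Coordinate form of `ι`: `ι w = (w₀, w₁, 0)`. [folklore] -/
theorem embedXY_eq_toLp (w : ℝ²) : embedXY w = toLp 2 ![w 0, w 1, 0] := by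
  ext i; fin_cases i <;> simp

/-- `π ∘ ι = id`. [folklore] -/
@[simp] theorem projXY_embedXY (w : ℝ²) : projXY (embedXY w) = w := by
  ext i; fin_cases i <;> rfl

/-- The vertical unit vector projects to zero. [folklore] -/
@[simp] theorem projXY_eZ : projXY eZ = 0 := by
  ext i; fin_cases i <;> simp [eZ]

/-- The projection does not see vertical translations. [folklore] -/
theorem projXY_add_smul_eZ (x : ℝ³) (z : ℝ) : projXY (x + z • eZ) = projXY x := by
  simp

/-- `x = ι(π x) + x₂ e_z`. [folklore] -/
theorem embedXY_projXY_add (x : ℝ³) : embedXY (projXY x) + x 2 • eZ = x := by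
  ext i; fin_cases i <;> simp [eZ]

/-- The tree's splitting `cylSplit : ℝ³ ≃ᵐ ℝ × ℝ²` in terms of `ι` and `e_z`:
`cylSplit.symm (z, w) = ι w + z e_z`. [folklore] -/
theorem cylSplit_symm_eq (z : ℝ) (w : ℝ²) : cylSplit.symm (z, w) = embedXY w + z • eZ := by
  rw [cylSplit_symm_apply]
  ext i; fin_cases i <;> simp [eZ]

/-- `π (cylSplit.symm (z, w)) = w`. [folklore] -/
@[simp] theorem projXY_cylSplit_symm (z : ℝ) (w : ℝ²) : projXY (cylSplit.symm (z, w)) = w := by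
  rw [cylSplit_symm_eq]; simp

/-- The horizontal component of `cylSplit x` is `π x`. [folklore] -/
@[simp] theorem cylSplit_apply_snd (x : ℝ³) : (cylSplit x).2 = projXY x := by
  ext i; fin_cases i <;> rfl

/-- **Adjointness**: `⟪ι v, y⟫ = ⟪v, π y⟫`. [folklore] -/
theorem inner_embedXY_left (v : ℝ²) (y : ℝ³) : ⟪embedXY v, y⟫ = ⟪v, projXY y⟫ := by
  simp [PiLp.inner_apply, Fin.sum_univ_three, Fin.sum_univ_two]

/-- `⟪y, ι v⟫ = ⟪π y, v⟫`. [folklore] -/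
theorem inner_embedXY_right (y : ℝ³) (v : ℝ²) : ⟪y, embedXY v⟫ = ⟪projXY y, v⟫ := by
  rw [real_inner_comm, inner_embedXY_left, real_inner_comm]

/-- `ι` is isometric for the inner product. [folklore] -/
theorem inner_embedXY_embedXY (v w : ℝ²) : ⟪embedXY v, embedXY w⟫ = ⟪v, w⟫ := by
  rw [inner_embedXY_left, projXY_embedXY]

/-- `‖ι w‖ = ‖w‖`. [folklore] -/
@[simp] theorem norm_embedXY (w : ℝ²) : ‖embedXY w‖ = ‖w‖ := by
  rw [EuclideanSpace.norm_eq, EuclideanSpace.norm_eq, Fin.sum_univ_three, Fin.sum_univ_two]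
  simp

/-- `‖π‖ ≤ 1` (from the tree's `norm_planarProjE_le : ‖π x‖ ≤ ‖x‖`). [folklore] -/
theorem norm_projXY_clm_le : ‖projXY‖ ≤ 1 :=
  ContinuousLinearMap.opNorm_le_bound _ zero_le_one fun x => by
    rw [one_mul, projXY_eq]; exact FunctionSpaces.Torus.norm_planarProjE_le x

/-- `‖ι‖ ≤ 1`. [folklore] -/
theorem norm_embedXY_clm_le : ‖embedXY‖ ≤ 1 :=
  ContinuousLinearMap.opNorm_le_bound _ zero_le_one fun x => by
    rw [one_mul, norm_embedXY]

/-- `ι` maps the planar frame to the first two vectors of the spatial frame. [folklore] -/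
theorem embedXY_single (i : Fin 2) :
    embedXY (EuclideanSpace.single i 1) = EuclideanSpace.single (Fin.castSucc i) 1 := by
  ext j; fin_cases i <;> fin_cases j <;> simp

/-- `π` maps the first two vectors of the spatial frame to the planar frame. [folklore] -/
theorem projXY_single_castSucc (i : Fin 2) :
    projXY (EuclideanSpace.single (Fin.castSucc i) (1 : ℝ)) = EuclideanSpace.single i 1 := by
  ext j; fin_cases i <;> fin_cases j <;> simp

/-- `e_z ≠ 0`. [folklore] -/
theorem eZ_ne_zero : (eZ : ℝ³) ≠ 0 := fun h => by simpa [eZ] using congrArg (fun v : ℝ³ => v 2) h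

end XY

/-! ### Line integrals along a pencil of parallel lines -/

section LineIntegral

variable {V : Type*} [NormedAddCommGroup V] [NormedSpace ℝ V]
variable {P : Type*} [NormedAddCommGroup P] [NormedSpace ℝ P]
variable {F : Type*} [NormedAddCommGroup F] [NormedSpace ℝ F]

/-- The **line integral of `Φ` along the direction `e` through the point `L p`**:
`lineIntegralAlong L e Φ p = ∫ Φ (L p + s e) ds` (Bochner integral over `s ∈ ℝ`; fibre
integration along the pencil of parallel lines directed by `e`, parametrised linearly by `p`).
[folklore] -/
def lineIntegralAlong (L : P →L[ℝ] V) (e : V) (Φ : V → F) (p : P) : F :=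
  ∫ s : ℝ, Φ (L p + s • e)

/-- Unfolding `lineIntegralAlong`. [folklore] -/
theorem lineIntegralAlong_apply (L : P →L[ℝ] V) (e : V) (Φ : V → F) (p : P) :
    lineIntegralAlong L e Φ p = ∫ s : ℝ, Φ (L p + s • e) := rfl

/-- The linear parametrisation `(s, p) ↦ L p + s e` of the pencil, as a continuous linear map on
`ℝ × P`. [folklore] -/
def linePencil (L : P →L[ℝ] V) (e : V) : ℝ × P →L[ℝ] V :=
  L.comp (ContinuousLinearMap.snd ℝ ℝ P) + (ContinuousLinearMap.fst ℝ ℝ P).smulRight e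

/-- `linePencil L e (s, p) = L p + s e`. [folklore] -/
@[simp]
theorem linePencil_apply (L : P →L[ℝ] V) (e : V) (q : ℝ × P) :
    linePencil L e q = L q.2 + q.1 • e := rfl

variable {L : P →L[ℝ] V} {e : V} {Φ : V → F} {R ρ T : ℝ}

omit [NormedSpace ℝ F] in
/-- **Where the integrand vanishes.** If `Φ = 0` outside the closed ball of radius `R` and
`‖p‖ ≤ ρ`, then `Φ (L p + s e) = 0` as soon as `|s| > (R + ‖L‖ ρ) / ‖e‖` (reverse triangle
inequality). [folklore] -/
theorem apply_linePencil_eq_zero (he : e ≠ 0) (hΦ : ∀ y, R < ‖y‖ → Φ y = 0) {p : P}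
    (hp : ‖p‖ ≤ ρ) {s : ℝ} (hs : (R + ‖L‖ * ρ) / ‖e‖ < |s|) : Φ (L p + s • e) = 0 := by
  apply hΦ
  have he' : 0 < ‖e‖ := norm_pos_iff.2 he
  have h1 : R + ‖L‖ * ρ < |s| * ‖e‖ := (div_lt_iff₀ he').1 hs
  have h2 : ‖L p‖ ≤ ‖L‖ * ρ := (L.le_opNorm p).trans (by gcongr)
  have h3 : ‖s • e‖ ≤ ‖L p + s • e‖ + ‖L p‖ := by
    calc ‖s • e‖ = ‖(L p + s • e) - L p‖ := by rw [add_sub_cancel_left]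
      _ ≤ ‖L p + s • e‖ + ‖L p‖ := norm_sub_le _ _
  rw [norm_smul, Real.norm_eq_abs] at h3
  linarith

/-- **Interval form.** Under the same support hypothesis the line integral over `ℝ` is an
integral over the compact interval `[-T, T]` for every `T > (R + ‖L‖ ρ) / ‖e‖`, `T ≥ 0`,
uniformly in `‖p‖ ≤ ρ`. [folklore] -/
theorem lineIntegralAlong_eq_intervalIntegral (he : e ≠ 0) (hΦ : ∀ y, R < ‖y‖ → Φ y = 0)
    (hT : (R + ‖L‖ * ρ) / ‖e‖ < T) (hT0 : 0 ≤ T) {p : P} (hp : ‖p‖ ≤ ρ) :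
    lineIntegralAlong L e Φ p = ∫ s in -T..T, Φ (L p + s • e) := by
  rw [lineIntegralAlong, intervalIntegral.integral_of_le (by linarith : -T ≤ T)]
  refine (setIntegral_eq_integral_of_forall_compl_eq_zero fun s hs => ?_).symm
  refine apply_linePencil_eq_zero he hΦ hp (hT.trans_le ?_)
  simp only [mem_Ioc, not_and_or, not_lt, not_le] at hs
  rcases hs with hs | hs
  · rw [abs_of_nonpos (by linarith)]; linarith
  · exact hs.le.trans (le_abs_self s)

/-- The support hypothesis is inherited by directional derivatives (the zero set `{R < ‖y‖}`
is open). [folklore] -/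
theorem fderiv_apply_eq_zero_of_norm_lt (hΦ : ∀ y, R < ‖y‖ → Φ y = 0) (v : V) :
    ∀ y, R < ‖y‖ → fderiv ℝ Φ y v = 0 := by
  intro y hy
  have hopen : IsOpen {y : V | R < ‖y‖} := isOpen_lt continuous_const continuous_norm
  have h0 : Φ =ᶠ[𝓝 y] fun _ => (0 : F) :=
    Filter.eventually_of_mem (hopen.mem_nhds hy) fun z hz => hΦ z hz
  rw [h0.fderiv_eq, fderiv_fun_const]
  rfl

omit [NormedSpace ℝ V] [NormedSpace ℝ F] in
/-- A compactly supported function on a normed group vanishes outside some closed ball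
(Mathlib's `HasCompactSupport.exists_pos_le_norm`, strict form). [folklore] -/
theorem exists_forall_norm_lt_eq_zero_of_hasCompactSupport {Φ : V → F}
    (hΦ : HasCompactSupport Φ) : ∃ R, 0 < R ∧ ∀ y, R < ‖y‖ → Φ y = 0 := by
  obtain ⟨R, hR, h⟩ := hΦ.exists_pos_le_norm
  exact ⟨R, hR, fun y hy => h y hy.le⟩

/-- The radius `(R + ‖L‖ ρ) / ‖e‖` is nonnegative for `R, ρ ≥ 0`. [folklore] -/
theorem lineRadius_nonneg (hR : 0 ≤ R) (hρ : 0 ≤ ρ) : 0 ≤ (R + ‖L‖ * ρ) / ‖e‖ := by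
  positivity

omit [NormedSpace ℝ P] in
/-- Points of the unit ball about `p₀` have norm at most `‖p₀‖ + 1`. [folklore] -/
theorem norm_le_of_mem_ball_one {p p₀ : P} (hp : p ∈ ball p₀ 1) : ‖p‖ ≤ ‖p₀‖ + 1 := by
  have h1 : ‖p - p₀‖ < 1 := mem_ball_iff_norm.1 hp
  have h2 := norm_le_norm_add_norm_sub' p p₀
  linarith

omit [NormedSpace ℝ F] in
/-- A continuous compactly supported `Φ` is integrable along every line of the pencil.
[folklore] -/
theorem integrable_comp_linePencil (he : e ≠ 0) (hΦ : Continuous Φ) (hΦc : HasCompactSupport Φ)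
    (p : P) : Integrable (fun s : ℝ => Φ (L p + s • e)) := by
  obtain ⟨R, -, hΦR⟩ := exists_forall_norm_lt_eq_zero_of_hasCompactSupport hΦc
  set T : ℝ := (R + ‖L‖ * ‖p‖) / ‖e‖ + 1 with hTdef
  have hT : (R + ‖L‖ * ‖p‖) / ‖e‖ < T := by simp [hTdef]
  refine (hΦ.comp (continuous_const.add (continuous_id.smul continuous_const))
    ).integrable_of_hasCompactSupport ?_
  refine HasCompactSupport.intro (K := Icc (-T) T) isCompact_Icc fun s hs => ?_
  refine apply_linePencil_eq_zero he hΦR le_rfl ?_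
  simp only [mem_Icc, not_and_or, not_le] at hs
  rcases hs with hs | hs
  · exact hT.trans (lt_of_lt_of_le (by linarith) (neg_le_abs s))
  · exact hT.trans (lt_of_lt_of_le hs (le_abs_self s))

/-- The integrand `Φ ∘ linePencil L e` is `Cⁿ` when `Φ` is. [folklore] -/
theorem contDiff_comp_linePencil {n : WithTop ℕ∞} (hΦs : ContDiff ℝ n Φ) :
    ContDiff ℝ n fun q : ℝ × P => Φ (L q.2 + q.1 • e) := by
  have : (fun q : ℝ × P => Φ (L q.2 + q.1 • e)) = Φ ∘ linePencil L e := by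
    funext q; simp
  rw [this]
  exact hΦs.comp (linePencil L e).contDiff

/-- The partial derivative of the integrand in the parameter:
`D(Φ ∘ linePencil)(s, p)(0, q) = DΦ(L p + s e)(L q)`. [folklore] -/
theorem fderiv_comp_linePencil_apply {n : WithTop ℕ∞} (hΦs : ContDiff ℝ n Φ) (hn : n ≠ 0)
    (s : ℝ) (p q : P) :
    fderiv ℝ (fun q : ℝ × P => Φ (L q.2 + q.1 • e)) (s, p) ((0 : ℝ), q) =
      fderiv ℝ Φ (L p + s • e) (L q) := by
  have heq : (fun q : ℝ × P => Φ (L q.2 + q.1 • e)) = Φ ∘ linePencil L e := by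
    funext q; simp
  rw [heq, fderiv_comp _ ((hΦs.differentiable hn) _) (linePencil L e).differentiableAt,
    ContinuousLinearMap.fderiv]
  simp

/-- **The derivative along the fibre integrates to zero**: `∫ DΦ(L p + s e)(e) ds = 0` for
`Φ ∈ C_c^1` (the fundamental theorem of calculus for the compactly supported
`s ↦ Φ (L p + s e)`). [folklore] -/
theorem lineIntegralAlong_fderiv_apply_self [CompleteSpace F] (he : e ≠ 0) {n : WithTop ℕ∞}
    (hΦs : ContDiff ℝ n Φ) (hn : n ≠ 0) (hΦc : HasCompactSupport Φ) (p : P) :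
    lineIntegralAlong L e (fun y => fderiv ℝ Φ y e) p = 0 := by
  obtain ⟨R, hR, hΦR⟩ := exists_forall_norm_lt_eq_zero_of_hasCompactSupport hΦc
  set ρ : ℝ := ‖p‖ with hρ
  set T : ℝ := (R + ‖L‖ * ρ) / ‖e‖ + 1 with hTdef
  have hT : (R + ‖L‖ * ρ) / ‖e‖ < T := by simp [hTdef]
  have hT0 : 0 ≤ T := by
    have := lineRadius_nonneg (L := L) (e := e) hR.le (norm_nonneg p)
    linarith
  rw [lineIntegralAlong_eq_intervalIntegral he (fderiv_apply_eq_zero_of_norm_lt hΦR e) hT hT0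
    (le_rfl : ‖p‖ ≤ ρ)]
  have hd : ∀ s, HasDerivAt (fun s : ℝ => Φ (L p + s • e)) (fderiv ℝ Φ (L p + s • e) e) s := by
    intro s
    have h1 : HasDerivAt (fun s : ℝ => L p + s • e) e s := by
      simpa using ((hasDerivAt_id s).smul_const e).const_add (L p)
    exact (((hΦs.differentiable hn) _).hasFDerivAt).comp_hasDerivAt s h1
  have hcont : Continuous fun s : ℝ => fderiv ℝ Φ (L p + s • e) e :=
    ((hΦs.continuous_fderiv hn).comp
      (continuous_const.add (continuous_id.smul continuous_const))).clm_apply continuous_const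
  rw [intervalIntegral.integral_eq_sub_of_hasDerivAt (fun s _ => hd s) (hcont.intervalIntegrable _ _)]
  have hTpos : (R + ‖L‖ * ρ) / ‖e‖ < |T| := hT.trans_le (le_abs_self T)
  rw [apply_linePencil_eq_zero he hΦR le_rfl hTpos,
    apply_linePencil_eq_zero he hΦR le_rfl (by rwa [abs_neg]), sub_zero]

variable [FiniteDimensional ℝ P]

/-- **Smoothness of line integrals of test functions.** If `Φ` is `C^∞` with compact support
and `e ≠ 0`, then `p ↦ ∫ Φ (L p + s e) ds` is `C^∞`: locally in `p` it is a parametric integral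
over a fixed compact interval of the smooth integrand `Φ ∘ linePencil L e` (differentiation under
the integral sign, Hörmander Thm. 1.1.9, through the tree's
`contDiff_parametric_intervalIntegral`). [folklore] -/
theorem contDiff_lineIntegralAlong (he : e ≠ 0) (hΦs : ContDiff ℝ ∞ Φ)
    (hΦc : HasCompactSupport Φ) : ContDiff ℝ ∞ (lineIntegralAlong L e Φ) := by
  obtain ⟨R, hR, hΦR⟩ := exists_forall_norm_lt_eq_zero_of_hasCompactSupport hΦc
  refine contDiff_iff_contDiffAt.2 fun p₀ => ?_
  set ρ : ℝ := ‖p₀‖ + 1 with hρ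
  set T : ℝ := (R + ‖L‖ * ρ) / ‖e‖ + 1 with hTdef
  have hT : (R + ‖L‖ * ρ) / ‖e‖ < T := by simp [hTdef]
  have hT0 : 0 ≤ T := by
    have := lineRadius_nonneg (L := L) (e := e) hR.le (by positivity : 0 ≤ ρ)
    linarith
  have hG : ContDiff ℝ ∞ fun p : P => ∫ s in -T..T, Φ (L p + s • e) :=
    FunctionSpaces.contDiff_parametric_intervalIntegral (contDiff_comp_linePencil hΦs) (-T) T
  refine hG.contDiffAt.congr_of_eventuallyEq ?_
  filter_upwards [Metric.ball_mem_nhds p₀ one_pos] with p hp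
  exact lineIntegralAlong_eq_intervalIntegral he hΦR hT hT0 (norm_le_of_mem_ball_one hp)

/-- **Differentiation under the line integral.** For `Φ ∈ C_c^∞` and `e ≠ 0`,
`D(∫ Φ (L · + s e) ds)(p)(q) = ∫ DΦ(L p + s e)(L q) ds`. [folklore] -/
theorem fderiv_lineIntegralAlong_apply (he : e ≠ 0) (hΦs : ContDiff ℝ ∞ Φ)
    (hΦc : HasCompactSupport Φ) (p q : P) :
    fderiv ℝ (lineIntegralAlong L e Φ) p q =
      lineIntegralAlong L e (fun y => fderiv ℝ Φ y (L q)) p := by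
  obtain ⟨R, hR, hΦR⟩ := exists_forall_norm_lt_eq_zero_of_hasCompactSupport hΦc
  set ρ : ℝ := ‖p‖ + 1 with hρ
  set T : ℝ := (R + ‖L‖ * ρ) / ‖e‖ + 1 with hTdef
  have hT : (R + ‖L‖ * ρ) / ‖e‖ < T := by simp [hTdef]
  have hT0 : 0 ≤ T := by
    have := lineRadius_nonneg (L := L) (e := e) hR.le (by positivity : 0 ≤ ρ)
    linarith
  have h1 : (∞ : WithTop ℕ∞) ≠ 0 := by simp
  have hev : lineIntegralAlong L e Φ =ᶠ[𝓝 p] fun p : P => ∫ s in -T..T, Φ (L p + s • e) := by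
    filter_upwards [Metric.ball_mem_nhds p one_pos] with p' hp'
    exact lineIntegralAlong_eq_intervalIntegral he hΦR hT hT0 (norm_le_of_mem_ball_one hp')
  rw [hev.fderiv_eq, FunctionSpaces.fderiv_parametric_intervalIntegral_apply
    (contDiff_comp_linePencil hΦs) h1 (-T) T p q]
  rw [lineIntegralAlong_eq_intervalIntegral he (fderiv_apply_eq_zero_of_norm_lt hΦR (L q)) hT hT0
    (by simp [hρ] : ‖p‖ ≤ ρ)]
  refine intervalIntegral.integral_congr fun s _ => ?_
  exact fderiv_comp_linePencil_apply hΦs h1 s p q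

end LineIntegral

/-! ### Fibre integrals of fields on `ℝ³` along the vertical direction (unnormalised) -/

section FiberInt

variable {F : Type*} [NormedAddCommGroup F] [NormedSpace ℝ F]

/-- The **vertical fibre integral** of a static field on `ℝ³`:
`vertInt Φ w = ∫ Φ (w₀, w₁, z) dz` (`= lineIntegralAlong ι e_z Φ w`). [folklore] -/
def vertInt (Φ : ℝ³ → F) (w : ℝ²) : F :=
  lineIntegralAlong embedXY eZ Φ w

/-- Unfolding `vertInt` as an integral over the fibre `{ι w + z e_z}`. [folklore] -/
theorem vertInt_apply (Φ : ℝ³ → F) (w : ℝ²) : vertInt Φ w = ∫ z : ℝ, Φ (embedXY w + z • eZ) :=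
  rfl

/-- `vertInt` in the variables of `cylSplit`: `vertInt Φ w = ∫ Φ (cylSplit.symm (z, w)) dz`.
[folklore] -/
theorem vertInt_eq_integral_cylSplit_symm (Φ : ℝ³ → F) (w : ℝ²) :
    vertInt Φ w = ∫ z : ℝ, Φ (cylSplit.symm (z, w)) := by
  simp_rw [cylSplit_symm_eq]; rfl

/-- The **fibre integral of a time-dependent field** on `ℝ³`, slice by slice (an unnormalised
integral over the non-compact fibre `ℝ`, like `vertInt`):
`fiberInt ψ t w = ∫ ψ t (w₀, w₁, z) dz`. [folklore] -/
def fiberInt (ψ : ℝ → ℝ³ → F) (t : ℝ) (w : ℝ²) : F :=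
  vertInt (ψ t) w

/-- Unfolding `fiberInt`. [folklore] -/
theorem fiberInt_apply (ψ : ℝ → ℝ³ → F) (t : ℝ) (w : ℝ²) :
    fiberInt ψ t w = ∫ z : ℝ, ψ t (embedXY w + z • eZ) := rfl

/-- The space–time horizontal embedding `(t, w) ↦ (t, ι w)`. [folklore] -/
def stEmbedXY : ℝ × ℝ² →L[ℝ] ℝ × ℝ³ :=
  (ContinuousLinearMap.id ℝ ℝ).prodMap embedXY

/-- `stEmbedXY (t, w) = (t, ι w)`. [folklore] -/
@[simp]
theorem stEmbedXY_apply (q : ℝ × ℝ²) : stEmbedXY q = (q.1, embedXY q.2) := rfl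

/-- The space–time vertical direction `(0, e_z)` is nonzero. [folklore] -/
theorem st_eZ_ne_zero : (((0 : ℝ), (eZ : ℝ³)) : ℝ × ℝ³) ≠ 0 := fun h =>
  eZ_ne_zero (Prod.mk.inj h).2

/-- The uncurried fibre integral is a line integral on space–time along `(0, e_z)`. [folklore] -/
theorem uncurry_fiberInt (ψ : ℝ → ℝ³ → F) :
    uncurry (fiberInt ψ) = lineIntegralAlong stEmbedXY ((0 : ℝ), (eZ : ℝ³)) (uncurry ψ) := by
  funext q
  obtain ⟨t, w⟩ := q
  simp [fiberInt, vertInt, lineIntegralAlong]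

/-- **Fibre integrals of smooth compactly supported fields are smooth**. [folklore] -/
theorem contDiff_vertInt {Φ : ℝ³ → F} (hΦs : ContDiff ℝ ∞ Φ) (hΦc : HasCompactSupport Φ) :
    ContDiff ℝ ∞ (vertInt Φ) :=
  contDiff_lineIntegralAlong eZ_ne_zero hΦs hΦc

/-- **Horizontal derivatives pass under the fibre integral**:
`D(vertInt Φ)(w)(v) = vertInt (DΦ(·)(ι v)) w`. [folklore] -/
theorem fderiv_vertInt_apply {Φ : ℝ³ → F} (hΦs : ContDiff ℝ ∞ Φ) (hΦc : HasCompactSupport Φ)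
    (w v : ℝ²) :
    fderiv ℝ (vertInt Φ) w v = vertInt (fun y => fderiv ℝ Φ y (embedXY v)) w :=
  fderiv_lineIntegralAlong_apply eZ_ne_zero hΦs hΦc w v

/-- Second horizontal derivatives pass under the fibre integral. [folklore] -/
theorem fderiv_fderiv_vertInt_apply {Φ : ℝ³ → F} (hΦs : ContDiff ℝ ∞ Φ)
    (hΦc : HasCompactSupport Φ) (w v v' : ℝ²) :
    fderiv ℝ (fun w => fderiv ℝ (vertInt Φ) w v) w v' =
      vertInt (fun y => fderiv ℝ (fun y => fderiv ℝ Φ y (embedXY v)) y (embedXY v')) w := by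
  have h1 : (fun w => fderiv ℝ (vertInt Φ) w v) = vertInt (fun y => fderiv ℝ Φ y (embedXY v)) :=
    funext fun w => fderiv_vertInt_apply hΦs hΦc w v
  rw [h1]
  exact fderiv_vertInt_apply ((hΦs.fderiv_right le_rfl).clm_apply contDiff_const)
    (hΦc.fderiv_apply ℝ (embedXY v)) w v'

variable [CompleteSpace F]

/-- **Vertical derivatives integrate to zero**: `vertInt (DΦ(·)(e_z)) = 0`. [folklore] -/
theorem vertInt_fderiv_eZ {Φ : ℝ³ → F} {n : WithTop ℕ∞} (hΦs : ContDiff ℝ n Φ) (hn : n ≠ 0)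
    (hΦc : HasCompactSupport Φ) (w : ℝ²) :
    vertInt (fun y => fderiv ℝ Φ y eZ) w = 0 :=
  lineIntegralAlong_fderiv_apply_self eZ_ne_zero hΦs hn hΦc w

/-- **The Laplacian passes under the fibre integral**: `Δ₂ (vertInt Φ) = vertInt (Δ₃ Φ)` for
`Φ ∈ C_c^∞(ℝ³)` — over the coordinate frames `Δ = Σ ∂ᵢ∂ᵢ`; the horizontal second derivatives
commute with the integral and the vertical one `∂_z² Φ` integrates to zero. [folklore] -/
theorem laplacian_vertInt {Φ : ℝ³ → F} (hΦs : ContDiff ℝ ∞ Φ) (hΦc : HasCompactSupport Φ)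
    (w : ℝ²) : Δ (vertInt Φ) w = vertInt (Δ Φ) w := by
  classical
  have h2v : ContDiff ℝ 2 (vertInt Φ) := contDiff_infty.1 (contDiff_vertInt hΦs hΦc) 2
  have h2Φ : ContDiff ℝ 2 Φ := contDiff_infty.1 hΦs 2
  rw [laplacian_eq_sum_fderiv_fderiv_normed (EuclideanSpace.basisFun (Fin 2) ℝ) h2v]
  -- second partials of `Φ` along the spatial frame
  set D2 : Fin 3 → ℝ³ → F := fun j y => fderiv ℝ (fun y => fderiv ℝ Φ y
      (EuclideanSpace.basisFun (Fin 3) ℝ j)) y (EuclideanSpace.basisFun (Fin 3) ℝ j) with hD2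
  have hΔ : (Δ Φ : ℝ³ → F) = fun y => ∑ j, D2 j y :=
    funext fun y => laplacian_eq_sum_fderiv_fderiv_normed (EuclideanSpace.basisFun (Fin 3) ℝ) h2Φ y
  rw [hΔ]
  have hD1s : ∀ v : ℝ³, ContDiff ℝ ∞ (fun y => fderiv ℝ Φ y v) := fun v =>
    (hΦs.fderiv_right le_rfl).clm_apply contDiff_const
  have hD1c : ∀ v : ℝ³, HasCompactSupport (fun y => fderiv ℝ Φ y v) := fun v =>
    hΦc.fderiv_apply ℝ v
  have hD2cont : ∀ j, Continuous (D2 j) := fun j =>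
    (((hD1s _).fderiv_right (m := ∞) le_rfl).clm_apply contDiff_const).continuous
  have hD2c : ∀ j, HasCompactSupport (D2 j) := fun j => (hD1c _).fderiv_apply ℝ _
  have hint : ∀ j, Integrable (fun z : ℝ => D2 j (embedXY w + z • eZ)) := fun j =>
    integrable_comp_linePencil eZ_ne_zero (hD2cont j) (hD2c j) w
  have hsum : vertInt (fun y => ∑ j, D2 j y) w = ∑ j, vertInt (D2 j) w := by
    simp only [vertInt_apply]
    rw [integral_finsetSum _ fun j _ => hint j]
  rw [hsum]
  conv_rhs => rw [Fin.sum_univ_castSucc]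
  have hlast : vertInt (D2 (Fin.last 2)) w = 0 := by
    have he : EuclideanSpace.basisFun (Fin 3) ℝ (Fin.last 2) = eZ := by
      rw [EuclideanSpace.basisFun_apply]; rfl
    simp only [hD2, he]
    exact vertInt_fderiv_eZ (hD1s eZ) (by simp) (hD1c eZ) w
  rw [hlast, add_zero]
  refine Finset.sum_congr rfl fun i _ => ?_
  rw [fderiv_fderiv_vertInt_apply hΦs hΦc]
  congr 1
  funext y
  simp only [hD2, EuclideanSpace.basisFun_apply, embedXY_single]

omit [CompleteSpace F] in
/-- **Fibre integrals of space–time test fields on a slab are space–time test fields on the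
planar slab**: smooth by differentiation under the integral, supported in the (compact)
horizontal shadow of the support, whose time projection stays inside `I`. [folklore] -/
theorem isSpaceTimeTestOn_fiberInt {I : Set ℝ} {hI : IsOpen I} {ψ : ℝ → ℝ³ → F}
    (hψ : IsSpaceTimeTestOn (slab ℝ³ I hI) ψ) :
    IsSpaceTimeTestOn (slab ℝ² I hI) (fiberInt ψ) := by
  set K : Set (ℝ × ℝ³) := tsupport (uncurry ψ) with hK
  set K' : Set (ℝ × ℝ²) := Prod.map id projXY '' K with hK'
  have hKc : IsCompact K := hψ.hasCompactSupport
  have hK'c : IsCompact K' := hKc.image (continuous_id.prodMap projXY.continuous)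
  have hsupp : ∀ q : ℝ × ℝ², q ∉ K' → uncurry (fiberInt ψ) q = 0 := by
    rintro ⟨t, w⟩ hq
    have hzero : ∀ z : ℝ, ψ t (embedXY w + z • eZ) = 0 := by
      intro z
      by_contra hne
      refine hq ⟨(t, embedXY w + z • eZ), subset_tsupport _ (by simpa using hne), ?_⟩
      simp
    simp [fiberInt, vertInt, lineIntegralAlong, hzero]
  refine ⟨?_, HasCompactSupport.intro hK'c hsupp, ?_⟩
  · rw [uncurry_fiberInt]
    exact contDiff_lineIntegralAlong st_eZ_ne_zero hψ.contDiff hψ.hasCompactSupport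
  · have h1 : tsupport (uncurry (fiberInt ψ)) ⊆ K' :=
      closure_minimal (fun q hq => by_contra fun h => hq (hsupp q h)) hK'c.isClosed
    refine h1.trans ?_
    rintro _ ⟨⟨t, x⟩, hx, rfl⟩
    have ht : t ∈ I := mem_slab.1 (hψ.tsupport_subset hx)
    exact mem_slab.2 ht

omit [CompleteSpace F] in
/-- **Time derivatives pass under the fibre integral**: `∂ₜ(fiberInt ψ) = fiberInt (∂ₜψ)` for a
space–time test field `ψ` (differentiate the space–time line integral in the direction
`(1, 0)`). [folklore] -/
theorem IsSpaceTimeTestOn.timeDeriv_fiberInt {Q : Opens (ℝ × ℝ³)} {ψ : ℝ → ℝ³ → F}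
    (hψ : IsSpaceTimeTestOn Q ψ) (t : ℝ) (w : ℝ²) :
    timeDeriv (fiberInt ψ) t w = fiberInt (timeDeriv ψ) t w := by
  set G : ℝ × ℝ² → F := lineIntegralAlong stEmbedXY ((0 : ℝ), (eZ : ℝ³)) (uncurry ψ) with hG
  have hGs : ContDiff ℝ ∞ G :=
    contDiff_lineIntegralAlong st_eZ_ne_zero hψ.contDiff hψ.hasCompactSupport
  have hslice : (fun s => fiberInt ψ s w) = fun s => G (s, w) := by
    funext s
    change uncurry (fiberInt ψ) (s, w) = G (s, w)
    rw [uncurry_fiberInt]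
  have hd : DifferentiableAt ℝ G (t, w) := (hGs.differentiable (by simp)).differentiableAt
  have hderiv := hd.hasFDerivAt.comp_hasDerivAt t ((hasDerivAt_id t).prodMk (hasDerivAt_const t w))
  have hderiv' : deriv (fun s => G (s, w)) t = fderiv ℝ G (t, w) ((1 : ℝ), (0 : ℝ²)) :=
    hderiv.deriv
  rw [timeDeriv, hslice, hderiv']
  rw [hG, fderiv_lineIntegralAlong_apply st_eZ_ne_zero hψ.contDiff hψ.hasCompactSupport]
  change _ = uncurry (fiberInt (timeDeriv ψ)) (t, w)
  rw [uncurry_fiberInt]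
  congr 1
  funext y
  obtain ⟨t', x⟩ := y
  rw [stEmbedXY_apply]
  simp only [map_zero]
  -- `∂ₜψ(t', x) = D(uncurry ψ)(t', x)(1, 0)`
  have hd' : DifferentiableAt ℝ (uncurry ψ) (t', x) :=
    (hψ.contDiff.differentiable (by simp)).differentiableAt
  change _ = deriv (fun s => ψ s x) t'
  exact ((hd'.hasFDerivAt.comp_hasDerivAt t'
    ((hasDerivAt_id t').prodMk (hasDerivAt_const t' x))).deriv).symm

end FiberInt

end Literature.Analysis.FluidPDE

end
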